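import Summits.FinalStateConjecture.FinalStateConjecture.Theorems.BartnikGapSettlingGapExhaustionContDiffOnPullbackField
import Summits.FinalStateConjecture.FinalStateConjecture.Theorems.BartnikGapSettlingGapExhaustionKillingCoordAt
import Summits.FinalStateConjecture.FinalStateConjecture.Theorems.BartnikGapSettlingGapExhaustionIsMetricOnMetricInCoords
import Summits.FinalStateConjecture.FinalStateConjecture.Theorems.BartnikGapSettlingGapExhaustionKillingPatching
import Summits.FinalStateConjecture.FinalStateConjecture.Theorems.BartnikGapSettlingGapExhaustionKillingUniqueContinuation
import Summits.FinalStateConjecture.FinalStateConjecture.Theorems.BartnikGapSettlingGapExhaustionKillingProlongationOf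
import Summits.FinalStateConjecture.FinalStateConjecture.Theorems.BartnikGapSettlingGapExhaustionKillingHessianSkew
import Summits.FinalStateConjecture.FinalStateConjecture.Theorems.BartnikGapSettlingGapExhaustionKillingHessianAlt
import Summits.FinalStateConjecture.FinalStateConjecture.Theorems.BartnikGapSettlingGapExhaustionCurvatureLikeAlgebra
import Summits.FinalStateConjecture.FinalStateConjecture.Theorems.BartnikGapSettlingGapExhaustionFirstOrderVanishing
import Summits.FinalStateConjecture.FinalStateConjecture.Theorems.BartnikGapSettlingGapExhaustionKillingJetBound
import HarnessLib

/-!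
# Crux `GapExhaustion` (stmt-FinalStateConjecture-10808), line `photon-shell-pseudoconvexity`:
# stub (G5-B) `stub_isKillingFieldOn_patching` — PATCHING of manifold-level Killing fields on the
# image of an immersed chart (node-facing form of §1e through the bridge §1e/G5)

Route `BartnikGapSettling`; helper (`--supports stmt-FinalStateConjecture-10808`) landing the
registered sub-stub (G5-B) of line lead c8 (wave 4): two Killing fields `K₁, K₂` of the spacetime
`𝓢` on the image `Ψ '' W` of an immersed chart (`W` open and CONNECTED, `Ψ` smooth on `W` with
injective differential) which agree on `Ψ '' U` for a nonempty open `U ⊆ W` agree on `Ψ '' W`.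
Proof: pull both back to coordinate Killing fields of `𝓢.metricInCoords Ψ` on `W` (bridge (G5-A1)
`stub_contDiffOn_pullbackField` + (G5-A2) `stub_killingCoord_of_isKillingFieldOn_at`, metric datum
(G5-0) `stub_isMetricOn_metricInCoords`),
patch in coordinates (§1e: (K-E) ∘ (K-D) ∘ (K-A4 ∘ K-A1/K-A2/K-A3) ∘ (K-B) ∘ (K-C)), and push the
equality forward through the invertible differentials `dΨ_y`. This is the form in which the
sweeps S3/S5/S6b of the node glue local Killing extensions near different points of a cylinder.
O'Neill 1983, Ch. 9, Lemma 9.27 (local form, through a chart).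
-/

noncomputable section

set_option maxSynthPendingDepth 3

-- D-0017: single-problem summit, `Summit.<S>.<S>.…` by design (cf. lakefile `weak.linter.dupNamespace`).
set_option linter.dupNamespace false

namespace Summit.FinalStateConjecture.FinalStateConjecture.Theorems

open Set Function Bundle
open Literature.Geometry.Lorentzian Literature.Geometry.Lorentzian.MetricCoord
open scoped Manifold ContDiff Topology

/-- **Stub (G5-B) of the line `photon-shell-pseudoconvexity` (crux `GapExhaustion`,
stmt-FinalStateConjecture-10808) — patching of Killing fields on the image of an immersed chart.**
Let `Ψ : E4 → 𝓢.carrier` be smooth on the open connected set `W` with injective differential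
there, `U ⊆ W` nonempty open, and `K₁, K₂` Killing fields of `𝓢` on `Ψ '' W`
(`IsKillingFieldOn`) with `K₁ (Ψ y) = K₂ (Ψ y)` for `y ∈ U`. Then `K₁ (Ψ y) = K₂ (Ψ y)` for all
`y ∈ W` (O'Neill 1983, Ch. 9, Lemma 9.27 in local form: unique continuation of Killing fields,
read through the chart). [cite: ONeill1983, Ch. 9, Lemma 9.27] -/
theorem stub_isKillingFieldOn_patching :
    ∀ (𝓢 : Spacetime.{0} 4) [𝓢.metric.HasLeviCivita] (Ψ : E4 → 𝓢.carrier) (W U : Set E4)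
      (K₁ K₂ : Π x : 𝓢.carrier, TangentSpace (𝓡 4) x),
      IsOpen W → IsConnected W → IsOpen U → U ⊆ W → U.Nonempty →
      ContMDiffOn 𝓘(ℝ, E4) (𝓡 4) ∞ Ψ W →
      (∀ y ∈ W, Function.Injective (mfderiv 𝓘(ℝ, E4) (𝓡 4) Ψ y)) →
      𝓢.metric.toPseudoRiemannianMetric.IsKillingFieldOn K₁ (Ψ '' W) →
      𝓢.metric.toPseudoRiemannianMetric.IsKillingFieldOn K₂ (Ψ '' W) →
      (∀ y ∈ U, K₁ (Ψ y) = K₂ (Ψ y)) →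
      ∀ y ∈ W, K₁ (Ψ y) = K₂ (Ψ y) := by
  intro 𝓢 _ Ψ W U K₁ K₂ hW hconn hU hUW hUne hΨ hinj hK₁ hK₂ hagree y hy
  -- the two pulled-back coordinate Killing fields ((G5-A1) smoothness + (G5-A2) the equation)
  have hbridge : ∀ K : Π x : 𝓢.carrier, TangentSpace (𝓡 4) x,
      𝓢.metric.toPseudoRiemannianMetric.IsKillingFieldOn K (Ψ '' W) →
      ContDiffOn ℝ 2 (fun y : E4 => (mfderiv 𝓘(ℝ, E4) (𝓡 4) Ψ y).inverse (K (Ψ y))) W ∧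
      ∀ y ∈ W, ∀ v w : E4,
        fderiv ℝ (𝓢.metricInCoords Ψ) y ((mfderiv 𝓘(ℝ, E4) (𝓡 4) Ψ y).inverse (K (Ψ y))) v w
          + 𝓢.metricInCoords Ψ y
              (fderiv ℝ (fun y : E4 => (mfderiv 𝓘(ℝ, E4) (𝓡 4) Ψ y).inverse (K (Ψ y))) y v) w
          + 𝓢.metricInCoords Ψ y v
              (fderiv ℝ (fun y : E4 => (mfderiv 𝓘(ℝ, E4) (𝓡 4) Ψ y).inverse (K (Ψ y))) y w)
          = 0 := by
    intro K hK
    have hsmooth : ContDiffOn ℝ ∞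
        (fun y : E4 => (mfderiv 𝓘(ℝ, E4) (𝓡 4) Ψ y).inverse (K (Ψ y))) W :=
      stub_contDiffOn_pullbackField 𝓢 Ψ W K hW hΨ hinj hK.contMDiffOn
    refine ⟨hsmooth.of_le (ENat.LEInfty.out : (2 : ℕ∞ω) ≤ ∞), fun z hz v w => ?_⟩
    have hd : DifferentiableAt ℝ
        (fun y : E4 => (mfderiv 𝓘(ℝ, E4) (𝓡 4) Ψ y).inverse (K (Ψ y))) z :=
      ((hsmooth z hz).contDiffAt (hW.mem_nhds hz)).differentiableAt (by simp)
    exact stub_killingCoord_of_isKillingFieldOn_at 𝓢 Ψ W K hW hΨ hinj hK z hz hd v w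
  obtain ⟨hC₁, hKil₁⟩ := hbridge K₁ hK₁
  obtain ⟨hC₂, hKil₂⟩ := hbridge K₂ hK₂
  have hG : IsMetricOn (𝓢.metricInCoords Ψ) W := stub_isMetricOn_metricInCoords 𝓢 Ψ W hW hΨ hinj
  -- agreement of the pull-backs on `U`
  have hagree' : ∀ z ∈ U,
      (fun y : E4 => (mfderiv 𝓘(ℝ, E4) (𝓡 4) Ψ y).inverse (K₁ (Ψ y))) z =
        (fun y : E4 => (mfderiv 𝓘(ℝ, E4) (𝓡 4) Ψ y).inverse (K₂ (Ψ y))) z := by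
    intro z hz
    simp only [hagree z hz]
  -- patch in coordinates (§1e)
  have hpatch := stub_killingPatching_of
    (stub_killingUniqueContinuation_of
      (stub_killingProlongation_of stub_killingHessianSkew stub_killingHessianAlt
        stub_curvatureLikeAlgebra)
      stub_firstOrderVanishing stub_killingJetBound_of)
    (𝓢.metricInCoords Ψ) W U _ _ hG hconn hU hUW hUne hC₁ hC₂ hKil₁ hKil₂ hagree' y hy
  -- push forward through the invertible differential
  have hinv : (mfderiv 𝓘(ℝ, E4) (𝓡 4) Ψ y).IsInvertible :=
    PseudoRiemannianMetric.isInvertible_mfderiv_of_injective (I := 𝓡 4) (I' := 𝓘(ℝ, E4)) rfl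
      (hinj y hy)
  have h₁ : mfderiv 𝓘(ℝ, E4) (𝓡 4) Ψ y ((mfderiv 𝓘(ℝ, E4) (𝓡 4) Ψ y).inverse (K₁ (Ψ y))) =
      K₁ (Ψ y) := hinv.self_apply_inverse _
  have h₂ : mfderiv 𝓘(ℝ, E4) (𝓡 4) Ψ y ((mfderiv 𝓘(ℝ, E4) (𝓡 4) Ψ y).inverse (K₂ (Ψ y))) =
      K₂ (Ψ y) := hinv.self_apply_inverse _
  rw [← h₁, ← h₂]
  exact congrArg (mfderiv 𝓘(ℝ, E4) (𝓡 4) Ψ y) hpatch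

end Summit.FinalStateConjecture.FinalStateConjecture.Theorems

end
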